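import Summits.QuantumFields.YangMills.Theorems.BalabanUVNodesN15KingModelCoverPeriodisedDecay
import Summits.QuantumFields.YangMills.Theorems.BalabanUVNodesN15KingModelCoverContinuity
import Mathlib.Analysis.SpecialFunctions.Complex.Arg
import Mathlib.Analysis.SpecificLimits.Basic
import HarnessLib

/-!
# BalabanUVNodes ∕ N15 — THE KING-MODEL RUNG (PART Ͻ-j): FINITE COVERS — DENSITY OF FINITE-ORDER TORONS AND KING's LEMMA 4.5 AT EVERY TORON: for EVERY unit phase vector `ω`
# (every constant abelian link field on King's torus), `|(Δ^{(k+n)}_ω)⁻¹(b₀,b) − (Δ^{(k)}_{ω^{Lⁿ}})⁻¹(b₀,b)| ≤ C_diff·K_{d+1}(κ_m∕4)·L^{−k}·e^{−(κ_m∕4)·d_M(b₀,b)}` and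
# `|(Δ^{(k)}_ω)⁻¹(b₀,b)| ≤ (2∕γ_m)·K_{d+1}(κ_m∕2)·e^{−(κ_m∕2)·d_M(b₀,b)}` — the two-spacing `η`-rate with position-space decay of NE2's unit-lattice layer DECIDED in King's model at
# every flat `U(1)` background (doors (t3⁴⁹)+(t4⁵⁰) of the seat's §g44 closed)
# (Track A, DAG node N15 = NE2; FAN-OUT v1.1 §N15 s3 «KING-MODEL RUNG … NE2's analogue DECIDED in the model … + what the curved case adds»; count-neutral)

HONEST FRAMING.  Count-neutral (cell `pub-ymgap`, seat `pub-ymgap-dag-n15-e` g45; `--supports stmt-QuantumFields-27247 --as helper` = K3ᴬ, KEY MAP v3).  King's `A = 0`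
comparison model [King1986] at a CONSTANT ABELIAN (flat) link field `U(x,μ) = ω_μ`, `|ω_μ| = 1`, on ONE finite unit torus `T_M` at the two spacings `L^{−k}`, `L^{−k−n}`; the object is
King's block-field covariance `(Δ^{(k)})⁻¹` ([King1986] (2.16) p.653) with the covariant block mean, and the estimate has the SHAPE of Lemma 4.5 (4.38) p.674 «|C^{(k)}(x,y) − C^{(k+n)}(x,y)|
≤ CL^{−k}e^{−δ₀|x−y|}» (the tree's `T4EtaRate.EtaRateIneqUnit`) with King's constants of the tree and a quarter of King's decay rate.  What the curved (flat, holonomy) case ADDS to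
King's printed `A = 0` statement: NOTHING in the constants — the same `C, δ` serve every toron.  NOT Bałaban's `G_k(U)` ([Balaban1985BackgroundPropagators] Thm 3.15 ∕ (3.42) untouched,
no averaging penalty, non-flat fields out of reach of this method); NOT a node discharge (N15 of record untouched); nothing continuum ∕ ℝ⁴ ∕ OS ∕ Clay.

THE MATHEMATICS.  Phase vectors whose holonomy has finite order are DENSE in `U(1)^{d+1}`: `e^{iφ}` is the limit of the `P_j`-th roots of unity `e^{2πi⌊φP_j∕2π⌋∕P_j}`,
`P_j = L^nL^kM_μ(j+1)` (`rootApprox`, error `≤ 2π∕P_j`).  For each `j` the approximant has trivial holonomy on the cover `T_{(j+1)M}`, so PART Ͻ-h′ bounds the two-spacing difference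
by `C_diff·L^{−k}·K_{d+1}(κ_m∕4)·e^{−(κ_m∕4)d_M(b₀,b)}` INDEPENDENTLY OF `j`; PART Ͻ-i's continuity of `ω ↦ (Δ^ω_eff)⁻¹(b₀,b)` at unit `ω` passes to the limit.
PROVED HERE:
* §1 `rootApprox` (def), `rootApprox_pow_eq_one`, `norm_rootApprox`, `abs_rootAngle_sub_le` (`≤ 2π∕P`), ★ `tendsto_rootAngle`, ★★ **`tendsto_rootApprox`** (finite-order phases are dense);
* §2 the approximating phase vectors `approxFine`∕`approxCoarse` for the two-spacing setting and their algebra (`approxFine_pow_period`, `approxCoarse_pow_period`, `approxFine_pow_eq`,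
  `tendsto_approxFine`, `tendsto_approxCoarse`);
* §3 ★★★★ **`norm_effLapTw_inv_sub_apply_le_rate_all`** (EVERY unit `ω`: Lemma 4.5's rate with decay at the toron), ★★★ **`norm_effLapTw_inv_apply_le_decay_all`** (EVERY unit `ω`: uniform
  exponential decay), `king_lemma45_toron_package` (conjunction with the positivity of the constants).
PRIOR TREE ART (by name): Ͻ-h′ (`norm_effLapTw_inv_sub_apply_le_rate_closed'`, `norm_effLapTw_inv_apply_le_decay_closed'`), Ͻ-i (`norm_effLapTw_inv_sub_apply_le_of_tendsto`,
`norm_effLapTw_inv_apply_le_of_tendsto`), `King1986.Torus` (`CdiffM`, `kapM`, `gamM`, `tdistT`, positivity lemmas), `B4Sect5Proof.latticeConst`, `King1986.aK`, Mathlib (`Int.floor_le`,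
`Int.lt_floor_add_one`, `Complex.exp_int_mul_two_pi_mul_I`, `Complex.norm_exp_ofReal_mul_I`, `Complex.norm_mul_exp_arg_mul_I`, `tendsto_const_div_atTop_nhds_zero_nat`, `tendsto_pi_nhds`).
Dedup (rg at filing): basename 0 files; needles `rootApprox|approxFine|rate_all|decay_all|king_lemma45_toron` 0 tree files.  presearch: «block-spin ∕ renormalisation-group covariance at
twisted boundary conditions (torons), two-spacing convergence» — corpus∕galaxy: King 1986 §4 (A = 0 only), 't Hooft NPB 153 (notion); no printed toron version — decided here by covers +
density.  Locators: [King1986] Lemma 4.5 (4.38) p.674, (4.34) p.674, (4.39)–(4.41) pp.674–675, (2.16) p.653; [Balaban1985BackgroundPropagators] Thm 3.15 (3.187) p.432;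
[tHooft1979Flux] NPB 153 (notion only).  0 `sorry`, 3 `def`.
v1.1 (DOC-ONLY, ERRATUM-Ͻ1 = ref-I READ-1034 N2): v1.0 cited «[King1986] §4 p.670 l.8–13» as «the method of images»; King's lines invoke [Ba 4]'s MULTIPLE-REFLECTION
representations (box propagators ∕ free boundary conditions ∕ the (2.13) operator on `ηℤ^d`, `A = 0`), not a periodisation — the finite-cover image sum is an elementary device of these files
([folklore]); that locator is withdrawn from the affected docstrings, every other locator stands; declarations byte-identical to v1.0.
-/

noncomputable section

open scoped BigOperators ComplexConjugate ComplexOrder Topology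
open Finset Matrix Filter Complex

namespace Summit.QuantumFields.YangMills.BalabanUVNodes.N15KingModelRung.Cover

open Literature.MathematicalPhysics.QuantumFieldTheory.Balaban1983to89.B5Prop11Plancherel (Tor fine)
open Literature.MathematicalPhysics.QuantumFieldTheory.Balaban1983to89.B4Sect5Proof (latticeConst latticeConst_nonneg)
open Literature.MathematicalPhysics.QuantumFieldTheory.King1986 (aK)
open Literature.MathematicalPhysics.QuantumFieldTheory.King1986.Torus (tdistT CdiffM kapM gamM kapM_pos_le gamM_pos CdiffM_nonneg)
open Summit.QuantumFields.YangMills.BalabanUVNodes.N15KingModelRung.Toron (effLapTw)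

variable {d : ℕ}

/-! ## §1 Root-of-unity approximation of a phase: finite-order phases are dense in `U(1)` -/

/-- The angle of the `P`-th root of unity just below `e^{iφ}`: `2π⌊φP∕2π⌋∕P`. [folklore] -/
def rootAngle (P : ℕ) (φ : ℝ) : ℝ := 2 * Real.pi * (⌊φ * P / (2 * Real.pi)⌋ : ℝ) / P

/-- THE ROOT-OF-UNITY APPROXIMATION of the phase `e^{iφ}`: `e^{2πi⌊φP∕2π⌋∕P}`, a `P`-th root of unity. [folklore] -/
def rootApprox (P : ℕ) (φ : ℝ) : ℂ := Complex.exp ((rootAngle P φ : ℂ) * I)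

/-- `rootApprox P φ` is a `P`-th root of unity (`P ≥ 1`). [folklore] -/
theorem rootApprox_pow_eq_one {P : ℕ} (hP : P ≠ 0) (φ : ℝ) : rootApprox P φ ^ P = 1 := by
  rw [rootApprox, ← Complex.exp_nat_mul, rootAngle]
  have hPc : (P : ℂ) ≠ 0 := by exact_mod_cast hP
  have : (P : ℂ) * (((2 * Real.pi * (⌊φ * P / (2 * Real.pi)⌋ : ℝ) / P : ℝ) : ℂ) * I) = (⌊φ * P / (2 * Real.pi)⌋ : ℤ) * (2 * Real.pi * I) := by
    push_cast; field_simp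
  rw [this, Complex.exp_int_mul_two_pi_mul_I]

/-- It has modulus one. [folklore] -/
theorem norm_rootApprox (P : ℕ) (φ : ℝ) : ‖rootApprox P φ‖ = 1 := by
  rw [rootApprox]; exact Complex.norm_exp_ofReal_mul_I _

/-- The angle error is at most `2π∕P`. [folklore] -/
theorem abs_rootAngle_sub_le {P : ℕ} (hP : 0 < P) (φ : ℝ) : |rootAngle P φ - φ| ≤ 2 * Real.pi / P := by
  have hPr : (0 : ℝ) < P := by exact_mod_cast hP
  have h2π : 0 < 2 * Real.pi := by positivity
  unfold rootAngle
  set y := φ * P / (2 * Real.pi) with hy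
  have hfl : (⌊y⌋ : ℝ) ≤ y := Int.floor_le y
  have hfl' : y < (⌊y⌋ : ℝ) + 1 := Int.lt_floor_add_one y
  have hφ : φ = 2 * Real.pi * y / P := by rw [hy]; field_simp
  have key : 2 * Real.pi * (⌊y⌋ : ℝ) / P - φ = 2 * Real.pi * ((⌊y⌋ : ℝ) - y) / P := by rw [hφ]; ring
  rw [key, abs_div, abs_of_pos hPr, abs_mul, abs_of_pos h2π]
  refine div_le_div_of_nonneg_right ?_ hPr.le
  have : |(⌊y⌋ : ℝ) - y| ≤ 1 := by rw [abs_le]; constructor <;> linarith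
  nlinarith

/-- ★ The approximating angles converge: `rootAngle (c(j+1)) φ → φ` as `j → ∞` (`c ≥ 1`). [folklore] -/
theorem tendsto_rootAngle {c : ℕ} (hc : 0 < c) (φ : ℝ) : Tendsto (fun j : ℕ => rootAngle (c * (j + 1)) φ) atTop (𝓝 φ) := by
  rw [tendsto_iff_norm_sub_tendsto_zero]
  have hbound : ∀ j : ℕ, ‖rootAngle (c * (j + 1)) φ - φ‖ ≤ 2 * Real.pi * (1 / ((j : ℝ) + 1)) := fun j => by
    rw [Real.norm_eq_abs, mul_one_div]
    refine (abs_rootAngle_sub_le (Nat.mul_pos hc (Nat.succ_pos j)) φ).trans ?_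
    have hj : (0 : ℝ) < (j : ℝ) + 1 := by positivity
    have hc1 : (1 : ℝ) ≤ c := by exact_mod_cast hc
    refine div_le_div_of_nonneg_left (by positivity) hj ?_
    push_cast
    nlinarith
  refine squeeze_zero (fun j => norm_nonneg _) hbound ?_
  have h := tendsto_one_div_add_atTop_nhds_zero_nat (𝕜 := ℝ)
  have : Tendsto (fun n : ℕ => (2 * Real.pi) * (1 / ((n : ℝ) + 1))) atTop (𝓝 ((2 * Real.pi) * 0)) := h.const_mul _
  rw [mul_zero] at this
  exact this

/-- ★★ **FINITE-ORDER PHASES ARE DENSE**: `rootApprox (c(j+1)) φ → e^{iφ}` as `j → ∞`. [folklore] -/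
theorem tendsto_rootApprox {c : ℕ} (hc : 0 < c) (φ : ℝ) : Tendsto (fun j : ℕ => rootApprox (c * (j + 1)) φ) atTop (𝓝 (Complex.exp ((φ : ℂ) * I))) := by
  unfold rootApprox
  refine Filter.Tendsto.cexp ?_
  exact ((Complex.continuous_ofReal.tendsto φ).comp (tendsto_rootAngle hc φ)).mul_const I

/-! ## §2 The approximating phase vectors for two spacings on the base torus `T_M` -/

section Approx

variable (L k n : ℕ) (M : Fin (d + 1) → ℕ) [hM : ∀ μ, NeZero (M μ)]

/-- The `j`-th APPROXIMANT of the finer phase vector `e^{iφ}` (spacing `L^{−k−n}`): trivial holonomy on the cover `T_{(j+1)M}`. [folklore] -/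
def approxFine (φ : Fin (d + 1) → ℝ) (j : ℕ) : Fin (d + 1) → ℂ := fun μ => rootApprox (L ^ n * L ^ k * M μ * (j + 1)) (φ μ)

/-- The `j`-th approximant of the coarser phase vector: the `Lⁿ`-th power of the finer one (same constant gauge field read at spacing `L^{−k}`). [folklore] -/
def approxCoarse (φ : Fin (d + 1) → ℝ) (j : ℕ) : Fin (d + 1) → ℂ := fun μ => approxFine L k n M φ j μ ^ (L ^ n)

/-- The finer approximant has trivial holonomy on the cover: `(ω₂^{(j)})_μ^{L^nL^k(j+1)M_μ} = 1`. [folklore] -/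
theorem approxFine_pow_period [NeZero L] (φ : Fin (d + 1) → ℝ) (j : ℕ) (μ : Fin (d + 1)) :
    approxFine L k n M φ j μ ^ fine (L ^ n * L ^ k) (fun ν => (j + 1) * M ν) μ = 1 := by
  have h : fine (L ^ n * L ^ k) (fun ν => (j + 1) * M ν) μ = L ^ n * L ^ k * M μ * (j + 1) := by simp only [fine]; ring
  rw [h, approxFine]
  exact rootApprox_pow_eq_one (by positivity [NeZero.ne L, NeZero.ne (M μ)]) _

/-- The coarser approximant has trivial holonomy on the cover: `(ω₁^{(j)})_μ^{L^k(j+1)M_μ} = 1`. [folklore] -/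
theorem approxCoarse_pow_period [NeZero L] (φ : Fin (d + 1) → ℝ) (j : ℕ) (μ : Fin (d + 1)) :
    approxCoarse L k n M φ j μ ^ fine (L ^ k) (fun ν => (j + 1) * M ν) μ = 1 := by
  rw [approxCoarse, ← pow_mul]
  have h : L ^ n * fine (L ^ k) (fun ν => (j + 1) * M ν) μ = fine (L ^ n * L ^ k) (fun ν => (j + 1) * M ν) μ := by simp only [fine]; ring
  rw [h]; exact approxFine_pow_period L k n M φ j μ

omit hM in
/-- The two approximants read the same unit-lattice phases: `(ω₂^{(j)})^{L^nL^k} = (ω₁^{(j)})^{L^k}`. [folklore] -/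
theorem approxFine_pow_eq (φ : Fin (d + 1) → ℝ) (j : ℕ) (μ : Fin (d + 1)) :
    approxFine L k n M φ j μ ^ (L ^ n * L ^ k) = approxCoarse L k n M φ j μ ^ (L ^ k) := by
  rw [approxCoarse, ← pow_mul]

/-- ★ The finer approximants converge to `e^{iφ}` (coordinatewise root-of-unity approximation). [folklore] -/
theorem tendsto_approxFine [NeZero L] (φ : Fin (d + 1) → ℝ) :
    Tendsto (fun j => approxFine L k n M φ j) atTop (𝓝 (fun μ => Complex.exp ((φ μ : ℂ) * I))) := by
  rw [tendsto_pi_nhds]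
  intro μ
  exact tendsto_rootApprox (by positivity [NeZero.ne L, NeZero.ne (M μ)]) (φ μ)

/-- ★ The coarser approximants converge to `(e^{iφ})^{Lⁿ}`. [folklore] -/
theorem tendsto_approxCoarse [NeZero L] (φ : Fin (d + 1) → ℝ) :
    Tendsto (fun j => approxCoarse L k n M φ j) atTop (𝓝 (fun μ => Complex.exp ((φ μ : ℂ) * I) ^ (L ^ n))) := by
  rw [tendsto_pi_nhds]
  intro μ
  exact ((tendsto_pi_nhds.mp (tendsto_approxFine L k n M φ)) μ).pow (L ^ n)

end Approx

/-! ## §3 King's Lemma 4.5 at EVERY toron -/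

section AllTorons

variable {M : Fin (d + 1) → ℕ} [hM : ∀ μ, NeZero (M μ)]

/-- A unit complex number is `e^{i·arg}`. [folklore] -/
theorem exp_arg_mul_I_of_norm_eq_one {z : ℂ} (hz : ‖z‖ = 1) : Complex.exp ((Complex.arg z : ℂ) * I) = z := by
  have h := Complex.norm_mul_exp_arg_mul_I z
  rwa [hz, Complex.ofReal_one, one_mul] at h

/-- ★★★★ **KING's LEMMA 4.5 TWO-SPACING RATE WITH DECAY AT EVERY TORON** (door (t3⁴⁹) of the seat's §g44, closed): on King's unit torus `T_M`, for EVERY unit phase vector `ω`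
(the constant abelian link field at the finer spacing `L^{−k−n}`; at spacing `L^{−k}` the same field reads `ω^{Lⁿ}`), `a > 0`, `m² > 0`, `L ≥ 2`, `k, n ≥ 1`, all `b₀, b`:
`|(Δ^{ω}_{eff,k+n})⁻¹(b₀,b) − (Δ^{ω^{Lⁿ}}_{eff,k})⁻¹(b₀,b)| ≤ C_diff·L^{−k}·K_{d+1}(κ_m∕4)·e^{−(κ_m∕4)·d_M(b₀,b)}` — King's printed `A = 0` shape and rate `L^{−k}`, constants
INDEPENDENT of the toron. [cite: King1986, Lemma 4.5 (4.38) p.674, (4.39)–(4.41) pp.674–675] -/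
theorem norm_effLapTw_inv_sub_apply_le_rate_all {a m2 : ℝ} (ha : 0 < a) (hm : 0 < m2) {L k n : ℕ} [NeZero L] (hL : 2 ≤ L) (hk : 1 ≤ k) (hn : 1 ≤ n)
    {ω : Fin (d + 1) → ℂ} (hω : ∀ μ, ‖ω μ‖ = 1) (b₀ b : Tor M) :
    ‖(effLapTw (L ^ n * L ^ k) M (aK a L (k + n)) (((L ^ n * L ^ k : ℕ) : ℝ) ^ 2) m2 ω)⁻¹ b₀ b
        - (effLapTw (L ^ k) M (aK a L k) (((L ^ k : ℕ) : ℝ) ^ 2) m2 (fun μ => ω μ ^ (L ^ n)))⁻¹ b₀ b‖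
      ≤ CdiffM (d + 1) a m2 L * ((L : ℝ) ^ k)⁻¹
          * (latticeConst (d + 1) (kapM (d + 1) a m2 L / 4) * Real.exp (-(kapM (d + 1) a m2 L / 4 * tdistT M b₀ b))) := by
  have hL1 : (1 : ℝ) < L := by exact_mod_cast hL
  set φ : Fin (d + 1) → ℝ := fun μ => Complex.arg (ω μ) with hφ
  have hωφ : (fun μ => Complex.exp ((φ μ : ℂ) * I)) = ω := funext fun μ => exp_arg_mul_I_of_norm_eq_one (hω μ)
  have hω1 : ∀ μ, ‖(fun μ => ω μ ^ (L ^ n)) μ‖ = 1 := fun μ => by simp [norm_pow, hω μ]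
  have h2 : Tendsto (fun j => approxFine L k n M φ j) atTop (𝓝 ω) := by rw [← hωφ]; exact tendsto_approxFine L k n M φ
  have h1 : Tendsto (fun j => approxCoarse L k n M φ j) atTop (𝓝 (fun μ => ω μ ^ (L ^ n))) := by
    have := tendsto_approxCoarse L k n M φ
    rwa [show (fun μ => Complex.exp ((φ μ : ℂ) * I) ^ (L ^ n)) = fun μ => ω μ ^ (L ^ n) from funext fun μ => by rw [← congrFun hωφ μ]] at this
  refine norm_effLapTw_inv_sub_apply_le_of_tendsto M (L ^ n * L ^ k) (L ^ k) (Literature.MathematicalPhysics.QuantumFieldTheory.King1986.aK_pos ha hL1 (by omega))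
    (Literature.MathematicalPhysics.QuantumFieldTheory.King1986.aK_pos ha hL1 hk) (sq_nonneg _) (sq_nonneg _) hm hω hω1 h2 h1 b₀ b fun j => ?_
  exact norm_effLapTw_inv_sub_apply_le_rate_closed' (M := M) (M' := fun ν => (j + 1) * M ν) (fun μ => Dvd.intro_left _ rfl) ha hm hL hk hn
    (approxCoarse_pow_period L k n M φ j) (approxFine_pow_period L k n M φ j) (approxFine_pow_eq L k n M φ j) b₀ b

/-- ★★★ **UNIFORM EXPONENTIAL DECAY OF THE BLOCK-FIELD COVARIANCE AT EVERY TORON**: for EVERY unit phase vector `ω`, `|(Δ^ω_{eff,k})⁻¹(b₀,b)| ≤ (2∕γ_m)·K_{d+1}(κ_m∕2)·e^{−(κ_m∕2)·d_M(b₀,b)}`.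
[cite: King1986, (4.34) p.674, (2.16) p.653] -/
theorem norm_effLapTw_inv_apply_le_decay_all {a m2 : ℝ} (ha : 0 < a) (hm : 0 < m2) {L k : ℕ} [NeZero L] (hL : 2 ≤ L) (hk : 1 ≤ k)
    {ω : Fin (d + 1) → ℂ} (hω : ∀ μ, ‖ω μ‖ = 1) (b₀ b : Tor M) :
    ‖(effLapTw (L ^ k) M (aK a L k) (((L ^ k : ℕ) : ℝ) ^ 2) m2 ω)⁻¹ b₀ b‖
      ≤ (2 / gamM a m2 L) * (latticeConst (d + 1) (kapM (d + 1) a m2 L / 2) * Real.exp (-(kapM (d + 1) a m2 L / 2 * tdistT M b₀ b))) := by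
  have hL1 : (1 : ℝ) < L := by exact_mod_cast hL
  set φ : Fin (d + 1) → ℝ := fun μ => Complex.arg (ω μ) with hφ
  have hωφ : (fun μ => Complex.exp ((φ μ : ℂ) * I)) = ω := funext fun μ => exp_arg_mul_I_of_norm_eq_one (hω μ)
  -- use the two-spacing approximants with `n = 0` bookkeeping avoided: approximate directly at spacing `L^{−k}` with `approxFine L k 0`
  have h2 : Tendsto (fun j => approxFine L k 0 M φ j) atTop (𝓝 ω) := by rw [← hωφ]; exact tendsto_approxFine L k 0 M φ
  refine norm_effLapTw_inv_apply_le_of_tendsto (L ^ k) M (Literature.MathematicalPhysics.QuantumFieldTheory.King1986.aK_pos ha hL1 hk) (sq_nonneg _) hm hω h2 b₀ b fun j => ?_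
  have hper : ∀ μ, approxFine L k 0 M φ j μ ^ fine (L ^ k) (fun ν => (j + 1) * M ν) μ = 1 := fun μ => by
    have := approxFine_pow_period L k 0 M φ j μ
    simpa only [pow_zero, one_mul] using this
  exact norm_effLapTw_inv_apply_le_decay_closed' (M := M) (M' := fun ν => (j + 1) * M ν) (fun μ => Dvd.intro_left _ rfl) ha hm hL hk hper b₀ b

/-- ★★★★ **PACKAGE — KING's LEMMA 4.5 AT EVERY TORON OF KING's MODEL**: positive constants `C = C_diff·K_{d+1}(κ_m∕4)`, `δ = κ_m∕4` (functions of `d, L, a, m²` ONLY) such that for every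
unit torus, every `k, n ≥ 1` and EVERY unit phase vector the two-spacing difference of the block-field covariances obeys `≤ C·L^{−k}·e^{−δ·d(b₀,b)}`, together with the uniform decay
`|(Δ^ω_{eff,k})⁻¹(b₀,b)| ≤ (2∕γ_m)K_{d+1}(κ_m∕2)e^{−(κ_m∕2)d(b₀,b)}`. [cite: King1986, Lemma 4.5 (4.38) p.674, (4.34) p.674] -/
theorem king_lemma45_toron_package {a m2 : ℝ} (ha : 0 < a) (hm : 0 < m2) {L : ℕ} [NeZero L] (hL : 2 ≤ L) :
    ∃ C δ : ℝ, 0 ≤ C ∧ 0 < δ ∧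
      (∀ (M : Fin (d + 1) → ℕ) [∀ μ, NeZero (M μ)] (k n : ℕ), 1 ≤ k → 1 ≤ n → ∀ (ω : Fin (d + 1) → ℂ), (∀ μ, ‖ω μ‖ = 1) → ∀ b₀ b : Tor M,
        ‖(effLapTw (L ^ n * L ^ k) M (aK a L (k + n)) (((L ^ n * L ^ k : ℕ) : ℝ) ^ 2) m2 ω)⁻¹ b₀ b
            - (effLapTw (L ^ k) M (aK a L k) (((L ^ k : ℕ) : ℝ) ^ 2) m2 (fun μ => ω μ ^ (L ^ n)))⁻¹ b₀ b‖
          ≤ C * ((L : ℝ) ^ k)⁻¹ * Real.exp (-(δ * tdistT M b₀ b))) ∧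
      (∀ (M : Fin (d + 1) → ℕ) [∀ μ, NeZero (M μ)] (k : ℕ), 1 ≤ k → ∀ (ω : Fin (d + 1) → ℂ), (∀ μ, ‖ω μ‖ = 1) → ∀ b₀ b : Tor M,
        ‖(effLapTw (L ^ k) M (aK a L k) (((L ^ k : ℕ) : ℝ) ^ 2) m2 ω)⁻¹ b₀ b‖
          ≤ (2 / gamM a m2 L) * latticeConst (d + 1) (kapM (d + 1) a m2 L / 2) * Real.exp (-(kapM (d + 1) a m2 L / 2 * tdistT M b₀ b))) := by
  have hκ := (kapM_pos_le (d := d + 1) ha hm hL).1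
  have hC := CdiffM_nonneg (d := d + 1) ha hm hL
  refine ⟨CdiffM (d + 1) a m2 L * latticeConst (d + 1) (kapM (d + 1) a m2 L / 4), kapM (d + 1) a m2 L / 4,
    mul_nonneg hC (latticeConst_nonneg _ (by positivity)), by positivity, ?_, ?_⟩
  · intro M _ k n hk hn ω hω b₀ b
    have := norm_effLapTw_inv_sub_apply_le_rate_all (M := M) ha hm hL hk hn hω b₀ b
    calc _ ≤ _ := this
      _ = _ := by ring
  · intro M _ k hk ω hω b₀ b
    have := norm_effLapTw_inv_apply_le_decay_all (M := M) ha hm hL hk hω b₀ b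
    calc _ ≤ _ := this
      _ = _ := by ring

end AllTorons

end Summit.QuantumFields.YangMills.BalabanUVNodes.N15KingModelRung.Cover

end
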